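import Summits.ResolutionOfSingularities.ResolutionOfSingularities.Theorems.FrobeniusLadderFRationalResolutionMonomialAlgebraDimension
import Summits.ResolutionOfSingularities.ResolutionOfSingularities.Theorems.FrobeniusLadderFRationalResolutionHfinOfChartData
import Summits.ResolutionOfSingularities.ResolutionOfSingularities.Theorems.FrobeniusLadderFRationalResolutionToricModelTransfer
import HarnessLib

/-!
# Crux `FrobeniusLadder.FRationalResolution` (stmt-ResolutionOfSingularities-15317), line `redirect`,
# stub `stub_diagonalizableQuotientResolution` — ★★★ `(κ[P]_𝔳)^ ≅ κ⟦P⟧`: THE COMPLETED LOCAL RING OF A MONOMIAL ALGEBRA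
# AT ITS VERTEX IS THE COMPLETED MONOID ALGEBRA (item (E″) of MEMO-15317-leafhand2-g18 §2c, closed)

* ★★ `exists_ringEquiv_monoidPowerSeries_adicCompletion_of_chart` — GENERIC form: `T` Noetherian `κ`-algebra, `𝔳` maximal with
  residue field `κ` (residue surjectivity on `T_𝔳`), a multiplicative chart `χ : P → T` (`P ⊆ ℕⁿ` finitely generated) with `χ(P ∖ 0) ⊆ 𝔳`
  generating `𝔳`, and `dim T_𝔳 = rank P` ⇒ a ring isomorphism `κ⟦P⟧ ≃+* (T_𝔳)^` with `x^p ↦ χ(p)` (Kato (3.2) (1), d = 0, as PROVED in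
  the tree: `…HfinOfChartData.exists_ringEquiv_monoidPowerSeries_of_chartData`, with the coefficient field `κ → (T_𝔳)^` from Mathlib's
  `AdicCompletion.residueField_map_bijective` and `dim (T_𝔳)^ = dim T_𝔳`, `ringKrullDim_adicCompletion`).
* ★★★ `exists_ringEquiv_monoidPowerSeries_adicCompletion` — for a finite `S ⊆ ℕⁿ ∖ {0}`, the monomial algebra
  `T = κ[χᵈ : d ∈ S] ⊆ κ[x₁,…,xₙ]` at its vertex `𝔳 = (χᵈ : d ∈ S)`: `κ⟦⟨S⟩⟧ ≃+* (T_𝔳)^`, `x^p ↦ χᵖ` (all hypotheses of the generic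
  form discharged by `…MonomialAlgebraVertex` / `…MonomialAlgebraDimension`).
* ★★★ `hloc_of_ringEquiv_monoidPowerSeries` — THE NAIVE RECIPE FROM `κ⟦P⟧`: Galois data at a twisted isolated point (p839495/p840407) +
  `Bl_𝔳(Spec κ[χᵈ : d ∈ S])` regular + a ring isomorphism `κ⟦⟨S⟩⟧ ≃+* Ê` ⇒ `hloc`. So for every class whose toric model has a regular
  vertex blow-up (all twisted Veronese cones `V(n,r)`, p807148) the ONLY remaining input is d = 0 Kato chart data on `Ê` by `⟨S⟩`
  (`…HfinOfChartData.exists_ringEquiv_monoidPowerSeries_of_chartData` once more) — item (E) of the memo.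

Statements never spell `AdicCompletion (maximalIdeal (Localization.AtPrime 𝔳)) _` for `𝔳` an ideal of a SUBALGEBRA: the two `CommSemiring`
paths on the localization of a subalgebra do not unify at instance transparency; the generic form is instantiated instead.
Honest label: plumbing toward ONE leaf stub (no stub, crux or summit closed). No definitions, no named facts, no sorry.
[cite: Kato1994, Thm. (3.2)] [cite: Matsumura1987, Thm. 8.11; Thm. 15.1; §32 p. 256]
-/

noncomputable section

-- single-problem summit: the doubled namespace component is forced
set_option linter.dupNamespace false

open CategoryTheory AlgebraicGeometry TopologicalSpace TensorProduct
open IsLocalRing MvPolynomial Literature.RingTheory.MvPowerSeries Literature.RingTheory.MvPowerSeries.monoidPowerSeries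
open Literature.AlgebraicGeometry.Resolution

namespace Summit.ResolutionOfSingularities.ResolutionOfSingularities.Theorems.FRationalResolution.MonomialAlgebraCompletion

/-- ★★ **Kato (3.2) (1) for `(T_𝔳)^`, generic form.** `T` a Noetherian `κ`-algebra, `𝔳` maximal with every element of `T_𝔳` a scalar
modulo `𝔳T_𝔳`, `χ : P → T` a multiplicative chart by a finitely generated `P ⊆ ℕⁿ` with `χ(P ∖ 0) ⊆ 𝔳` generating `𝔳`, and
`dim T_𝔳 = rank P`: then `κ⟦P⟧ ≃+* (T_𝔳)^`, `x^p ↦ χ(p)`. [cite: Kato1994, Thm. (3.2)] [cite: Matsumura1987, Thm. 8.11; Thm. 15.1] -/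
theorem exists_ringEquiv_monoidPowerSeries_adicCompletion_of_chart (κ : Type) [Field κ] {T : Type} [CommRing T] [Algebra κ T]
    [IsNoetherianRing T] (𝔳 : Ideal T) [h𝔳 : 𝔳.IsMaximal]
    (hres : ∀ x : Localization.AtPrime 𝔳, ∃ c : κ,
      x - algebraMap κ (Localization.AtPrime 𝔳) c ∈ maximalIdeal (Localization.AtPrime 𝔳))
    {n : ℕ} (P : AddSubmonoid (Fin n →₀ ℕ)) (hPfg : P.FG) (χ : (Fin n →₀ ℕ) → T) (hχ0 : χ 0 = 1)
    (hχadd : ∀ a ∈ P, ∀ b ∈ P, χ (a + b) = χ a * χ b) (hχm : ∀ p ∈ P, p ≠ 0 → χ p ∈ 𝔳)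
    (hgen : 𝔳 ≤ Ideal.span (χ '' {p | p ∈ P ∧ p ≠ 0}))
    (hdim : ringKrullDim (Localization.AtPrime 𝔳) = rank P) :
    ∃ e : ↥(monoidPowerSeries κ P) ≃+*
        AdicCompletion (maximalIdeal (Localization.AtPrime 𝔳)) (Localization.AtPrime 𝔳),
      ∀ (p : Fin n →₀ ℕ) (hp : p ∈ P),
        e ⟨MvPowerSeries.monomial p (1 : κ), monomial_mem hp 1⟩ = algebraMap T _ (χ p) := by
  classical
  haveI : IsNoetherianRing (Localization.AtPrime 𝔳) :=
    IsLocalization.isNoetherianRing 𝔳.primeCompl _ inferInstance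
  set L := Localization.AtPrime 𝔳 with hL
  haveI : IsNoetherianRing (AdicCompletion (maximalIdeal L) L) := isNoetherianRing_adicCompletion_maximalIdeal L
  -- the coefficient field
  let j : κ →+* AdicCompletion (maximalIdeal L) L :=
    (algebraMap L (AdicCompletion (maximalIdeal L) L)).comp (algebraMap κ L)
  haveI : IsLocalHom j := ⟨fun a ha => by
    rcases eq_or_ne a 0 with rfl | h
    · rw [map_zero] at ha; exact absurd ha not_isUnit_zero
    · exact h.isUnit⟩
  have hresE : ∀ a : AdicCompletion (maximalIdeal L) L, ∃ l : κ,
      a - j l ∈ maximalIdeal (AdicCompletion (maximalIdeal L) L) := by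
    intro a
    obtain ⟨x, hx⟩ := (AdicCompletion.residueField_map_bijective L).2 (IsLocalRing.residue _ a)
    obtain ⟨r, rfl⟩ := IsLocalRing.residue_surjective x
    rw [IsLocalRing.ResidueField.map_residue] at hx
    obtain ⟨c, hc⟩ := hres r
    refine ⟨c, ?_⟩
    have h1 : a - algebraMap L (AdicCompletion (maximalIdeal L) L) r ∈
        maximalIdeal (AdicCompletion (maximalIdeal L) L) := by
      rw [← Ideal.Quotient.mk_eq_mk_iff_sub_mem]
      exact hx.symm
    have h2 : algebraMap L (AdicCompletion (maximalIdeal L) L) (r - algebraMap κ L c) ∈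
        maximalIdeal (AdicCompletion (maximalIdeal L) L) := by
      rw [AdicCompletion.maximalIdeal_eq_map]
      exact Ideal.mem_map_of_mem _ hc
    have h3 : a - j c = (a - algebraMap L (AdicCompletion (maximalIdeal L) L) r) +
        algebraMap L (AdicCompletion (maximalIdeal L) L) (r - algebraMap κ L c) := by
      rw [map_sub, RingHom.comp_apply]; ring
    rw [h3]
    exact add_mem h1 h2
  -- the chart of `(T_𝔳)^`
  let φ : (Fin n →₀ ℕ) → AdicCompletion (maximalIdeal L) L := fun p => algebraMap T _ (χ p)
  have hφ0 : φ 0 = 1 := by simp only [φ, hχ0, map_one]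
  have hφadd : ∀ a ∈ P, ∀ b ∈ P, φ (a + b) = φ a * φ b := by
    intro a ha b hb; simp only [φ, hχadd a ha b hb, map_mul]
  have hmaxE : maximalIdeal (AdicCompletion (maximalIdeal L) L) =
      𝔳.map (algebraMap T (AdicCompletion (maximalIdeal L) L)) := by
    rw [AdicCompletion.maximalIdeal_eq_map, ← Localization.AtPrime.map_eq_maximalIdeal, Ideal.map_map]
    rfl
  have hφm : ∀ p ∈ P, p ≠ 0 → φ p ∈ maximalIdeal (AdicCompletion (maximalIdeal L) L) := by
    intro p hp hp0
    rw [hmaxE]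
    exact Ideal.mem_map_of_mem _ (hχm p hp hp0)
  have hgenE : maximalIdeal (AdicCompletion (maximalIdeal L) L) ≤ Ideal.span (φ '' {p | p ∈ P ∧ p ≠ 0}) := by
    rw [hmaxE]
    refine (Ideal.map_mono hgen).trans ?_
    rw [Ideal.map_span, ← Set.image_comp]
    rfl
  have hdimE : ringKrullDim (AdicCompletion (maximalIdeal L) L) = rank P := by
    rw [ringKrullDim_adicCompletion L]
    exact hdim
  exact HfinOfChartData.exists_ringEquiv_monoidPowerSeries_of_chartData κ j hresE P hPfg φ hφ0 hφadd hφm hgenE hdimE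

section Monomial

variable (κ : Type) [Field κ] {n : ℕ}

/-- The monomial algebra `κ[χᵈ : d ∈ S] ⊆ κ[x₁,…,xₙ]`. -/
local notation3 "T[" S "]" =>
  Algebra.adjoin κ ((fun d : Fin n →₀ ℕ => MvPolynomial.monomial d (1 : κ)) '' S)

/-- The vertex ideal `(χᵈ : d ∈ S)` of the monomial algebra. -/
local notation3 "V[" S "]" =>
  Ideal.span {v : ↥T[S] | ∃ d ∈ S, (v : MvPolynomial (Fin n) κ) = MvPolynomial.monomial d 1}

/-- ★ **The monomial chart of `κ[χᵈ : d ∈ S]`.** For `P = ⟨S⟩`, `0 ∉ S`: a multiplicative `χ : P → T`, `χ(p) = χᵖ`, with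
`χ(P ∖ 0) ⊆ 𝔳` generating the vertex ideal `𝔳` — the chart hypotheses of
`exists_ringEquiv_monoidPowerSeries_adicCompletion_of_chart`. [folklore; cite: Kato1994, Def. (2.1)] -/
theorem exists_chart (S : Set (Fin n →₀ ℕ)) (h0 : (0 : Fin n →₀ ℕ) ∉ S) (P : AddSubmonoid (Fin n →₀ ℕ))
    (hP : AddSubmonoid.closure S = P) :
    ∃ χ : (Fin n →₀ ℕ) → ↥T[S],
      (∀ p ∈ P, (χ p : MvPolynomial (Fin n) κ) = MvPolynomial.monomial p 1) ∧ χ 0 = 1 ∧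
      (∀ a ∈ P, ∀ b ∈ P, χ (a + b) = χ a * χ b) ∧ (∀ p ∈ P, p ≠ 0 → χ p ∈ V[S]) ∧
      V[S] ≤ Ideal.span (χ '' {p | p ∈ P ∧ p ≠ 0}) := by
  classical
  subst hP
  let χ : (Fin n →₀ ℕ) → ↥T[S] := fun p =>
    if hp : p ∈ AddSubmonoid.closure S then
      ⟨MvPolynomial.monomial p 1, MonomialAlgebraVertex.monomial_mem_of_mem_closure κ S hp⟩ else 0
  have hχ : ∀ p (hp : p ∈ AddSubmonoid.closure S),
      χ p = ⟨MvPolynomial.monomial p 1, MonomialAlgebraVertex.monomial_mem_of_mem_closure κ S hp⟩ :=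
    fun p hp => dif_pos hp
  refine ⟨χ, fun p hp => by rw [hχ p hp], ?_, ?_, ?_, ?_⟩
  · rw [hχ 0 (zero_mem _)]
    exact Subtype.ext (by simp)
  · intro a ha b hb
    rw [hχ a ha, hχ b hb, hχ (a + b) (add_mem ha hb)]
    exact Subtype.ext (by rw [Subalgebra.coe_mul, MvPolynomial.monomial_mul, mul_one])
  · intro p hp hp0
    rw [hχ p hp]
    exact MonomialAlgebraVertex.monomial_mem_vertexIdeal κ S hp hp0
  · apply Ideal.span_le.2
    rintro v ⟨d, hd, hv⟩
    have hd' : d ∈ AddSubmonoid.closure S := AddSubmonoid.subset_closure hd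
    refine Ideal.subset_span ⟨d, ⟨hd', ?_⟩, ?_⟩
    · rintro rfl; exact h0 hd
    · rw [hχ d hd']
      exact Subtype.ext hv.symm

/-- ★★★ **THE NAIVE RECIPE FROM `κ⟦P⟧`.** Galois data at a twisted isolated point as in p839495/p840407; if the monomial algebra
`T = κ[χᵈ : d ∈ S]` (finite `S ⊆ ℕⁿ ∖ {0}`, `P = ⟨S⟩`) has `Bl_𝔳(Spec T)` regular at its vertex and `Ê ≅ κ⟦P⟧` AS A RING, then `hloc`
holds at the point: `(T_𝔳)^ ≅ κ⟦P⟧ ≅ Ê` and `…ToricModelTransfer.hloc_of_ringEquiv_model`. The remaining input `κ⟦P⟧ ≃+* Ê` is d = 0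
Kato chart data on `Ê` by `P` (`…HfinOfChartData.exists_ringEquiv_monoidPowerSeries_of_chartData`).
[cite: Kato1994, Thm. (3.2)] [cite: Matsumura1987, Thm. 8.11; Thm. 8.14; §32 p. 256] [cite: StacksProject, Tag 07PT] -/
theorem hloc_of_ringEquiv_monoidPowerSeries (K : Type) [Field K] (X : Scheme.{0}) [IsIntegral X]
    (f : X ⟶ Spec (.of K)) [LocallyOfFiniteType f]
    {B : Type} [CommRing B] [IsDomain B] [Algebra K B] [Algebra.FiniteType K B]
    (ι : Spec (.of B) ⟶ X) [IsOpenImmersion ι] (hι : ι ≫ f = Spec.map (CommRingCat.ofHom (algebraMap K B)))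
    (𝔭 : Ideal B) [h𝔭 : 𝔭.IsMaximal] (h𝔭0 : 𝔭 ≠ ⊥)
    (hsing : ι ⟨𝔭, h𝔭.isPrime⟩ ∉ Scheme.regularLocus X)
    (hregB : ∀ P : Spec (.of B), P.asIdeal ≠ 𝔭 → P ∈ Scheme.regularLocus (Spec (.of B)))
    (K' : Type) [Field K'] [Algebra K K'] [FiniteDimensional K K'] [IsGalois K K']
    (𝔔' : Ideal (B ⊗[K] K')) [h𝔔' : 𝔔'.IsMaximal] (h𝔔'𝔭 : 𝔔'.comap (algebraMap B (B ⊗[K] K')) = 𝔭)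
    (S : Set (Fin n →₀ ℕ)) (hS : S.Finite) (h0 : (0 : Fin n →₀ ℕ) ∉ S) [h𝔳 : (V[S]).IsMaximal]
    (P : AddSubmonoid (Fin n →₀ ℕ)) (hP : AddSubmonoid.closure S = P)
    (hreg : Scheme.IsRegular (affineBlowup V[S]))
    (e : ↥(monoidPowerSeries κ P) ≃+*
      AdicCompletion (maximalIdeal (Localization.AtPrime 𝔔')) (Localization.AtPrime 𝔔')) :
    ∃ (V : X.Opens), ι ⟨𝔭, h𝔭.isPrime⟩ ∈ V ∧
      (∀ t : X, t ∉ Scheme.regularLocus X → t ∈ V → t = ι ⟨𝔭, h𝔭.isPrime⟩) ∧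
      ∃ (Y : Scheme.{0}) (ρ : Y ⟶ V), IsProper ρ ∧ Scheme.IsRegular Y ∧
        IsIso (ρ ∣_ (V.ι ⁻¹ᵁ ⟨Scheme.regularLocus X, isOpen_regularLocus_of_locallyOfFiniteType_field f⟩)) ∧
        Dense ((ρ ⁻¹ᵁ (V.ι ⁻¹ᵁ ⟨Scheme.regularLocus X,
          isOpen_regularLocus_of_locallyOfFiniteType_field f⟩) : Y.Opens) : Set Y) := by
  haveI : Algebra.FiniteType κ (↥T[S]) := MonomialAlgebraVertex.finiteType κ S hS
  haveI : IsNoetherianRing (↥T[S]) := Algebra.FiniteType.isNoetherianRing κ _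
  have hPfg : P.FG := ⟨hS.toFinset, by rw [Set.Finite.coe_toFinset, hP]⟩
  obtain ⟨χ, -, hχ0, hχadd, hχm, hgen⟩ := exists_chart κ S h0 P hP
  obtain ⟨e₀, -⟩ := exists_ringEquiv_monoidPowerSeries_adicCompletion_of_chart κ (V[S])
    (MonomialAlgebraVertex.exists_sub_algebraMap_mem_maximalIdeal κ S) P hPfg χ hχ0 hχadd hχm hgen
    (MonomialAlgebraDimension.ringKrullDim_localization_vertex_eq_rank κ S hS h0 P hP)
  exact ToricModelTransfer.hloc_of_ringEquiv_model K X f ι hι 𝔭 h𝔭0 hsing hregB K' 𝔔' h𝔔'𝔭 κ (V[S]) hreg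
    (e₀.symm.trans e)

end Monomial

end Summit.ResolutionOfSingularities.ResolutionOfSingularities.Theorems.FRationalResolution.MonomialAlgebraCompletion

end
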